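import Summits.CriticalPhenomena.PercolationContinuityZ3.Theorems.Transplant.TriFilmRouteCore
import HarnessLib

/-!
# Routing in the triangular films — THE TEMPLATE: a swap pair of routings from three planar legs (`k ≥ 2`)

builds on p205010 (kernel theorem, internal audit signed; external expert review pending) — NOT used in this file.  Lane `prim-bschramm`, seat
`prim-bschramm-p2` (gen 33; class C1b; memo `HOME/bschramm/P2-LATTICES.md` §121); helper file (`--supports stmt-CriticalPhenomena-4575 --as helper`).

THE TEMPLATE (DST's "three disjoint self-avoiding paths `γ_u, γ_v, γ_w`", p. 6, for `𝕋 × {0..k}`, `k ≥ 2`, in the swap-pair form of «HexShadowRouteData»).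
Terminals `E₁ = (a₁,h₁)`, `E₂ = (a₂,h₂)`, `w' = (a₃,h₃)`; planar legs `ℓᵢ : ρᵢ ⇝ aᵢ` from three distinct inner-ring points («TriFilmRouteCore», `exists_legs`).
Hub `c = (0,1)`; for `(e_y, e_b) ∈ {(2,0), (0,2)}`:
`L = ℓ₁ʳᵉᵛ@h₁ · column ρ₁ (h₁ → 1) · (0,1) · (0,e_y) · (ρ₂,e_y) · column ρ₂ (e_y → λ₂) · ℓ₂@λ₂ · column a₂ (λ₂ → h₂)` and
`c :: Br = (0,1) · (0,e_b) · (ρ₃,e_b) · column ρ₃ (e_b → λ₃) · ℓ₃@λ₃ · column a₃ (λ₃ → h₃)`, with auxiliary layers `λ₂ ≠ h₁` (`= h₂` unless `h₂ = h₁`) and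
`λ₃ ∉ {h₁, λ₂}` (`= e_b` when `a₃` is on the inner ring) among `{0,1,2}`.  The two choices of `(e_y, e_b)` exchange the successor `y = (0,e_y)` of `c` and the
first branch vertex `b = (0,e_b)`: a swap pair.  Legs sit in distinct layers; connectors in the columns `a₂, a₃` cross the other legs' layers only at points
those legs avoid; ring columns meet legs only at leg starts.
* **`TriFilm.exists_swap_pair_of_legs`**.
[cite: DuminilCopinSidoraviciusTassion2016, §2.3 (proof of Fact 2, pp. 6–7)]
-/

noncomputable section

namespace Summit.CriticalPhenomena.PercolationContinuityZ3.Theorems.Transplant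

open Literature.Probability.Percolation Literature.Probability.LatticeModels SimpleGraph
open scoped Classical

namespace TriFilm

variable {k : ℕ}

/-- **ONE ROUTING OF THE TEMPLATE** (parameters `e_y ≠ e_b` in `{0, 2}`): routing data with successor `y = (0, e_y)` and first branch vertex `b = (0, e_b)`.
[cite: DuminilCopinSidoraviciusTassion2016, §2.3 (proof of Fact 2)] -/
theorem exists_route_of_legs (hk : 2 ≤ k) {RP D : Set (Site 2)} (h0R : (0 : Site 2) ∈ RP) (h0D : (0 : Site 2) ∈ D) {a₁ a₂ a₃ ρ₁ ρ₂ ρ₃ : Site 2}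
    {ℓ₁ ℓ₂ ℓ₃ : List (Site 2)} (L1 : Leg RP {q | q ≠ a₁ ∧ (q = a₂ ∨ q = a₃)} ρ₁ a₁ ℓ₁) (L2 : Leg RP {q | q ≠ a₂ ∧ (q = a₁ ∨ q = a₃)} ρ₂ a₂ ℓ₂)
    (L3 : Leg D {q | q = a₁ ∨ q = a₂} ρ₃ a₃ ℓ₃) (h12 : ρ₁ ≠ ρ₂) (h31 : ρ₃ ≠ ρ₁) (h32 : ρ₃ ≠ ρ₂) (ha₁ : triNorm a₁ = 3) (ha₂ : triNorm a₂ = 3)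
    {h₁ h₂ h₃ : ℕ} (hh₁ : h₁ ≤ k) (hh₂ : h₂ ≤ k) (hh₃ : h₃ ≤ k) (hE : vx k a₁ h₁ ≠ vx k a₂ h₂) {ey eb : ℕ} (hey : ey = 0 ∨ ey = 2)
    (heb : eb = 0 ∨ eb = 2) (hyb : ey ≠ eb) :
    ∃ r : (hexShadow k).RouteData RP D (vx k a₁ h₁) (vx k a₂ h₂) (vx k a₃ h₃), r.y = vx k 0 ey ∧ r.b = vx k 0 eb := by
  -- planar facts
  have hρ₁ := L1.ring; have hρ₂ := L2.ring; have hρ₃ := L3.ring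
  have hρ₁0 := L1.rho_ne_zero; have hρ₂0 := L2.rho_ne_zero; have hρ₃0 := L3.rho_ne_zero
  have ha₃ℓ₁ : a₃ ∉ ℓ₁ := fun h => L1.not_avoid a₃ h ⟨fun e => L3.not_avoid a₃ L3.a_mem (Or.inl e), Or.inr rfl⟩
  have ha₃ℓ₂ : a₃ ∉ ℓ₂ := fun h => L2.not_avoid a₃ h ⟨fun e => L3.not_avoid a₃ L3.a_mem (Or.inr e), Or.inr rfl⟩
  have ha₁ℓ₃ : a₁ ∉ ℓ₃ := fun h => L3.not_avoid a₁ h (Or.inl rfl)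
  have ha₂ℓ₃ : a₂ ∉ ℓ₃ := fun h => L3.not_avoid a₂ h (Or.inr rfl)
  have ha₃a₁ : a₃ ≠ a₁ := fun e => L3.not_avoid a₃ L3.a_mem (Or.inl e)
  have ha₃a₂ : a₃ ≠ a₂ := fun e => L3.not_avoid a₃ L3.a_mem (Or.inr e)
  have ha₂ℓ₁ : a₂ ∈ ℓ₁ → a₁ = a₂ := fun h => by
    by_contra hne; exact L1.not_avoid a₂ h ⟨fun e => hne e.symm, Or.inl rfl⟩
  have ha₁ℓ₂ : a₁ ∈ ℓ₂ → a₁ = a₂ := fun h => by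
    by_contra hne; exact L2.not_avoid a₁ h ⟨hne, Or.inl rfl⟩
  have h0ℓ₁ : (0 : Site 2) ∉ ℓ₁ := fun h => L1.ne_zero 0 h rfl
  have h0ℓ₂ : (0 : Site 2) ∉ ℓ₂ := fun h => L2.ne_zero 0 h rfl
  have h0ℓ₃ : (0 : Site 2) ∉ ℓ₃ := fun h => L3.ne_zero 0 h rfl
  have ha₃0 : a₃ ≠ 0 := L3.ne_zero a₃ L3.a_mem
  have hρ₂ℓ₁ : ρ₂ ∉ ℓ₁ := fun h => h12 (L1.ring_only ρ₂ h hρ₂).symm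
  have hρ₃ℓ₁ : ρ₃ ∉ ℓ₁ := fun h => h31 (L1.ring_only ρ₃ h hρ₃)
  have hρ₁ℓ₂ : ρ₁ ∉ ℓ₂ := fun h => h12 (L2.ring_only ρ₁ h hρ₁)
  have hρ₃ℓ₂ : ρ₃ ∉ ℓ₂ := fun h => h32 (L2.ring_only ρ₃ h hρ₃)
  have hρ₁ℓ₃ : ρ₁ ∉ ℓ₃ := fun h => h31 (L3.ring_only ρ₁ h hρ₁).symm
  have hρ₂ℓ₃ : ρ₂ ∉ ℓ₃ := fun h => h32 (L3.ring_only ρ₂ h hρ₂).symm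
  have ha₁0 : a₁ ≠ 0 := by rintro rfl; simp [triNorm] at ha₁
  have ha₂0 : a₂ ≠ 0 := by rintro rfl; simp [triNorm] at ha₂
  have ha₂ρ₁ : a₂ ≠ ρ₁ := fun e => by rw [e, hρ₁] at ha₂; omega
  have ha₂ρ₂ : a₂ ≠ ρ₂ := fun e => by rw [e, hρ₂] at ha₂; omega
  have ha₂ρ₃ : a₂ ≠ ρ₃ := fun e => by rw [e, hρ₃] at ha₂; omega
  have ha₃ρ₁ : a₃ ≠ ρ₁ := by
    intro e
    by_cases hr : triNorm a₃ = 1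
    · exact h31 ((L3.ring_only a₃ L3.a_mem hr).symm.trans e)
    · exact hr (e ▸ hρ₁)
  have ha₃ρ₂ : a₃ ≠ ρ₂ := by
    intro e
    by_cases hr : triNorm a₃ = 1
    · exact h32 ((L3.ring_only a₃ L3.a_mem hr).symm.trans e)
    · exact hr (e ▸ hρ₂)
  -- in the ring case the third leg is trivial
  have hℓ₃ring : triNorm a₃ = 1 → ∀ q ∈ ℓ₃, q = a₃ := by
    intro hr q hq
    have hρa : ρ₃ = a₃ := (L3.ring_only a₃ L3.a_mem hr).symm
    obtain ⟨x, xs, hl⟩ := List.exists_cons_of_ne_nil L3.ne_nil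
    have hx : x = ρ₃ := by have := L3.head; simp [hl] at this; exact this
    cases xs with
    | nil => rw [hl] at hq; simp at hq; rw [hq, hx, hρa]
    | cons y ys =>
      exfalso
      have hlast := L3.last
      simp only [hl, List.getLast_cons_cons] at hlast
      have hmem : a₃ ∈ y :: ys := by rw [← hlast]; exact List.getLast_mem _
      have hnd := L3.nodup
      rw [hl, hx, hρa] at hnd
      exact (List.nodup_cons.1 hnd).1 hmem
  -- layers
  have h1k : 1 ≤ k := by omega
  have heyk : ey ≤ k := by omega
  have hebk : eb ≤ k := by omega
  have hey1 : ey ≠ 1 := by omega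
  have heb1 : eb ≠ 1 := by omega
  set lam₂ := lam2 h₁ h₂ with hlam₂
  have hl2k : lam₂ ≤ k := lam2_le h1k hh₂
  have hl2ne : lam₂ ≠ h₁ := lam2_ne h₁ h₂
  have hl2eq : a₁ = a₂ → lam₂ = h₂ := fun e => lam2_eq fun hh => hE (by rw [e, hh])
  set lam₃ := (if triNorm a₃ = 1 then eb else fresh h₁ lam₂) with hlam₃
  have hl3k : lam₃ ≤ k := by
    rw [hlam₃]; split_ifs
    · exact hebk
    · exact (fresh_spec h₁ lam₂).2.2.trans hk
  have hl3ring : triNorm a₃ = 1 → lam₃ = eb := fun h => by rw [hlam₃]; simp [h]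
  have hl3ne : ¬triNorm a₃ = 1 → lam₃ ≠ h₁ ∧ lam₃ ≠ lam₂ := fun h => by
    rw [hlam₃]; simp only [h, if_false]; exact ⟨(fresh_spec h₁ lam₂).1, (fresh_spec h₁ lam₂).2.1⟩
  -- the pieces of `L`
  have P1 : FPath k (lay k h₁ ℓ₁).reverse (vx k a₁ h₁) (vx k ρ₁ h₁) := (L1.fpath h₁ hh₁).reverse
  have P2 : FPath k (vseg k ρ₁ h₁ 1) (vx k ρ₁ h₁) (vx k ρ₁ 1) := fpath_vseg ρ₁ hh₁ h1k
  have HY : FPath k [vx k ρ₁ 1, vx k 0 1, vx k 0 ey, vx k ρ₂ ey] (vx k ρ₁ 1) (vx k ρ₂ ey) := fpath_hubY hk hρ₁ hρ₂ hey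
  have P6 : FPath k (vseg k ρ₂ ey lam₂) (vx k ρ₂ ey) (vx k ρ₂ lam₂) := fpath_vseg ρ₂ heyk hl2k
  have P7 : FPath k (lay k lam₂ ℓ₂) (vx k ρ₂ lam₂) (vx k a₂ lam₂) := L2.fpath lam₂ hl2k
  have P8 : FPath k (vseg k a₂ lam₂ h₂) (vx k a₂ lam₂) (vx k a₂ h₂) := fpath_vseg a₂ hl2k hh₂
  -- membership descriptions
  have mP1 : ∀ v ∈ (lay k h₁ ℓ₁).reverse, ∃ q ∈ ℓ₁, v = vx k q h₁ := fun v hv => mem_lay.1 (List.mem_reverse.1 hv)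
  have mHY : ∀ v ∈ [vx k ρ₁ 1, vx k 0 1, vx k 0 ey, vx k ρ₂ ey], v = vx k ρ₁ 1 ∨ v = vx k 0 1 ∨ v = vx k 0 ey ∨ v = vx k ρ₂ ey := by
    intro v hv; simpa using hv
  -- gluing `L`
  have S₁ : FPath k ((lay k h₁ ℓ₁).reverse ++ (vseg k ρ₁ h₁ 1).tail) (vx k a₁ h₁) (vx k ρ₁ 1) := by
    refine P1.trans P2 fun v hv2 hv1 => ?_
    obtain ⟨i, hi1, hi2, rfl⟩ := mem_vseg.1 hv2
    obtain ⟨q, hq, he⟩ := mP1 _ hv1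
    have hik : i ≤ k := le_trans hi2 (max_le hh₁ h1k)
    obtain ⟨rfl, rfl⟩ := (vx_inj hik hh₁).1 he
    rfl
  have mS₁ : ∀ v ∈ (lay k h₁ ℓ₁).reverse ++ (vseg k ρ₁ h₁ 1).tail, (∃ q ∈ ℓ₁, v = vx k q h₁) ∨ v ∈ vseg k ρ₁ h₁ 1 := fun v hv =>
    (mem_trans_imp hv).imp (mP1 v) id
  have S₂ : FPath k (((lay k h₁ ℓ₁).reverse ++ (vseg k ρ₁ h₁ 1).tail) ++ [vx k ρ₁ 1, vx k 0 1, vx k 0 ey, vx k ρ₂ ey].tail) (vx k a₁ h₁) (vx k ρ₂ ey) := by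
    refine S₁.trans HY fun v hv hvS => ?_
    rcases mHY v hv with rfl | rfl | rfl | rfl
    · rfl
    · exfalso
      rcases mS₁ _ hvS with ⟨q, hq, he⟩ | h
      · exact h0ℓ₁ (((vx_inj h1k hh₁).1 he).1 ▸ hq)
      · exact hρ₁0 (fst_of_mem_vseg h).symm
    · exfalso
      rcases mS₁ _ hvS with ⟨q, hq, he⟩ | h
      · exact h0ℓ₁ (((vx_inj heyk hh₁).1 he).1 ▸ hq)
      · exact hρ₁0 (fst_of_mem_vseg h).symm
    · exfalso
      rcases mS₁ _ hvS with ⟨q, hq, he⟩ | h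
      · exact hρ₂ℓ₁ (((vx_inj heyk hh₁).1 he).1 ▸ hq)
      · exact h12 (fst_of_mem_vseg h).symm
  set T₂ := ((lay k h₁ ℓ₁).reverse ++ (vseg k ρ₁ h₁ 1).tail) ++ [vx k ρ₁ 1, vx k 0 1, vx k 0 ey, vx k ρ₂ ey].tail with hT₂
  have mS₂ : ∀ v ∈ T₂, (∃ q ∈ ℓ₁, v = vx k q h₁) ∨ v ∈ vseg k ρ₁ h₁ 1 ∨ (v = vx k ρ₁ 1 ∨ v = vx k 0 1 ∨ v = vx k 0 ey ∨ v = vx k ρ₂ ey) := by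
    intro v hv
    rcases mem_trans_imp hv with h | h
    · rcases mS₁ v h with h' | h'
      · exact Or.inl h'
      · exact Or.inr (Or.inl h')
    · exact Or.inr (Or.inr (mHY v h))
  have S₃ : FPath k (T₂ ++ (vseg k ρ₂ ey lam₂).tail) (vx k a₁ h₁) (vx k ρ₂ lam₂) := by
    refine S₂.trans P6 fun v hv hvS => ?_
    obtain ⟨i, hi1, hi2, rfl⟩ := mem_vseg.1 hv
    have hik : i ≤ k := le_trans hi2 (max_le heyk hl2k)
    rcases mS₂ _ hvS with ⟨q, hq, he⟩ | h | h | h | h | h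
    · exact absurd (((vx_inj hik hh₁).1 he).1 ▸ hq) hρ₂ℓ₁
    · exact absurd (fst_of_mem_vseg h) h12.symm
    · exact absurd ((vx_inj hik h1k).1 h).1 h12.symm
    · exact absurd ((vx_inj hik h1k).1 h).1 hρ₂0
    · exact absurd ((vx_inj hik heyk).1 h).1 hρ₂0
    · exact h
  set T₃ := T₂ ++ (vseg k ρ₂ ey lam₂).tail with hT₃
  have mS₃ : ∀ v ∈ T₃, ((∃ q ∈ ℓ₁, v = vx k q h₁) ∨ v ∈ vseg k ρ₁ h₁ 1 ∨ (v = vx k ρ₁ 1 ∨ v = vx k 0 1 ∨ v = vx k 0 ey ∨ v = vx k ρ₂ ey)) ∨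
      v ∈ vseg k ρ₂ ey lam₂ := fun v hv => (mem_trans_imp hv).imp (mS₂ v) id
  have S₄ : FPath k (T₃ ++ (lay k lam₂ ℓ₂).tail) (vx k a₁ h₁) (vx k a₂ lam₂) := by
    refine S₃.trans P7 fun v hv hvS => ?_
    obtain ⟨q, hq, rfl⟩ := mem_lay.1 hv
    rcases mS₃ _ hvS with (⟨q', hq', he⟩ | h | h | h | h | h) | h
    · exact absurd ((vx_inj hl2k hh₁).1 he).2 hl2ne
    · have := fst_of_mem_vseg h; simp only [vx_fst] at this; exact absurd (this ▸ hq) hρ₁ℓ₂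
    · exact absurd (((vx_inj hl2k h1k).1 h).1 ▸ hq) hρ₁ℓ₂
    · exact absurd (((vx_inj hl2k h1k).1 h).1 ▸ hq) h0ℓ₂
    · exact absurd (((vx_inj hl2k heyk).1 h).1 ▸ hq) h0ℓ₂
    · obtain ⟨hq0, -⟩ := (vx_inj hl2k heyk).1 h; rw [hq0]
    · obtain ⟨i, hi1, hi2, he⟩ := mem_vseg.1 h
      have hik : i ≤ k := le_trans hi2 (max_le heyk hl2k)
      obtain ⟨hq', rfl⟩ := (vx_inj hl2k hik).1 he
      rw [hq']
  set T₄ := T₃ ++ (lay k lam₂ ℓ₂).tail with hT₄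
  have mS₄ : ∀ v ∈ T₄, (((∃ q ∈ ℓ₁, v = vx k q h₁) ∨ v ∈ vseg k ρ₁ h₁ 1 ∨ (v = vx k ρ₁ 1 ∨ v = vx k 0 1 ∨ v = vx k 0 ey ∨ v = vx k ρ₂ ey)) ∨
      v ∈ vseg k ρ₂ ey lam₂) ∨ (∃ q ∈ ℓ₂, v = vx k q lam₂) := fun v hv => (mem_trans_imp hv).imp (mS₃ v) (fun h => mem_lay.1 h)
  have SL : FPath k (T₄ ++ (vseg k a₂ lam₂ h₂).tail) (vx k a₁ h₁) (vx k a₂ h₂) := by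
    refine S₄.trans P8 fun v hv hvS => ?_
    obtain ⟨i, hi1, hi2, rfl⟩ := mem_vseg.1 hv
    have hik : i ≤ k := le_trans hi2 (max_le hl2k hh₂)
    rcases mS₄ _ hvS with ((⟨q', hq', he⟩ | h | h | h | h | h) | h) | ⟨q', hq', he⟩
    · -- a vertex of the first leg: `a₂ ∈ ℓ₁` forces `a₁ = a₂`, then the layers separate
      obtain ⟨hqa, hi⟩ := (vx_inj hik hh₁).1 he
      have haa : a₁ = a₂ := ha₂ℓ₁ (hqa ▸ hq')
      have := hl2eq haa
      -- `i` lies between `lam₂ = h₂` and `h₂`, so `i = h₂`; but `i = h₁ ≠ h₂`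
      exfalso; apply hE; rw [haa, ← hi]
      congr 1; omega
    · exact absurd (fst_of_mem_vseg h) ha₂ρ₁
    · exact absurd ((vx_inj hik h1k).1 h).1 ha₂ρ₁
    · exact absurd ((vx_inj hik h1k).1 h).1 ha₂0
    · exact absurd ((vx_inj hik heyk).1 h).1 ha₂0
    · exact absurd ((vx_inj hik heyk).1 h).1 ha₂ρ₂
    · exact absurd (fst_of_mem_vseg h) ha₂ρ₂
    · obtain ⟨-, rfl⟩ := (vx_inj hik hl2k).1 he; rfl
  set L := T₄ ++ (vseg k a₂ lam₂ h₂).tail with hLdef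
  have mL : ∀ v ∈ L, ((((∃ q ∈ ℓ₁, v = vx k q h₁) ∨ v ∈ vseg k ρ₁ h₁ 1 ∨ (v = vx k ρ₁ 1 ∨ v = vx k 0 1 ∨ v = vx k 0 ey ∨ v = vx k ρ₂ ey)) ∨
      v ∈ vseg k ρ₂ ey lam₂) ∨ (∃ q ∈ ℓ₂, v = vx k q lam₂)) ∨ v ∈ vseg k a₂ lam₂ h₂ := fun v hv => (mem_trans_imp hv).imp (mS₄ v) id
  -- columns of `L` lie in `RP`
  have hLRP : ∀ v ∈ L, ((v : triFilm k) : Site 2 × Site 1).1 ∈ RP := by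
    intro v hv
    rcases mL v hv with (((⟨q, hq, rfl⟩ | h | h | h | h | h) | h) | ⟨q, hq, rfl⟩) | h
    · exact L1.mem q hq
    · rw [fst_of_mem_vseg h]; exact L1.rho_R
    · rw [h]; exact L1.rho_R
    · rw [h]; exact h0R
    · rw [h]; exact h0R
    · rw [h]; exact L2.rho_R
    · rw [fst_of_mem_vseg h]; exact L2.rho_R
    · exact L2.mem q hq
    · rw [fst_of_mem_vseg h]; exact L2.a_R
  -- the pieces of the branch
  have HB : FPath k [vx k 0 1, vx k 0 eb, vx k ρ₃ eb] (vx k 0 1) (vx k ρ₃ eb) := fpath_hubB hk hρ₃ heb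
  have Q6 : FPath k (vseg k ρ₃ eb lam₃) (vx k ρ₃ eb) (vx k ρ₃ lam₃) := fpath_vseg ρ₃ hebk hl3k
  have Q7 : FPath k (lay k lam₃ ℓ₃) (vx k ρ₃ lam₃) (vx k a₃ lam₃) := L3.fpath lam₃ hl3k
  have Q8 : FPath k (vseg k a₃ lam₃ h₃) (vx k a₃ lam₃) (vx k a₃ h₃) := fpath_vseg a₃ hl3k hh₃
  have mHB : ∀ v ∈ [vx k 0 1, vx k 0 eb, vx k ρ₃ eb], v = vx k 0 1 ∨ v = vx k 0 eb ∨ v = vx k ρ₃ eb := by intro v hv; simpa using hv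
  have R₁ : FPath k ([vx k 0 1, vx k 0 eb, vx k ρ₃ eb] ++ (vseg k ρ₃ eb lam₃).tail) (vx k 0 1) (vx k ρ₃ lam₃) := by
    refine HB.trans Q6 fun v hv hvS => ?_
    obtain ⟨i, hi1, hi2, rfl⟩ := mem_vseg.1 hv
    have hik : i ≤ k := le_trans hi2 (max_le hebk hl3k)
    rcases mHB _ hvS with h | h | h
    · exact absurd ((vx_inj hik h1k).1 h).1 hρ₃0
    · exact absurd ((vx_inj hik hebk).1 h).1 hρ₃0
    · exact h
  set U₁ := [vx k 0 1, vx k 0 eb, vx k ρ₃ eb] ++ (vseg k ρ₃ eb lam₃).tail with hU₁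
  have mR₁ : ∀ v ∈ U₁, (v = vx k 0 1 ∨ v = vx k 0 eb ∨ v = vx k ρ₃ eb) ∨ v ∈ vseg k ρ₃ eb lam₃ := fun v hv => (mem_trans_imp hv).imp (mHB v) id
  have R₂ : FPath k (U₁ ++ (lay k lam₃ ℓ₃).tail) (vx k 0 1) (vx k a₃ lam₃) := by
    refine R₁.trans Q7 fun v hv hvS => ?_
    obtain ⟨q, hq, rfl⟩ := mem_lay.1 hv
    rcases mR₁ _ hvS with (h | h | h) | h
    · exact absurd (((vx_inj hl3k h1k).1 h).1 ▸ hq) h0ℓ₃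
    · exact absurd (((vx_inj hl3k hebk).1 h).1 ▸ hq) h0ℓ₃
    · obtain ⟨hq0, -⟩ := (vx_inj hl3k hebk).1 h; rw [hq0]
    · obtain ⟨i, hi1, hi2, he⟩ := mem_vseg.1 h
      have hik : i ≤ k := le_trans hi2 (max_le hebk hl3k)
      obtain ⟨hq', rfl⟩ := (vx_inj hl3k hik).1 he
      rw [hq']
  set U₂ := U₁ ++ (lay k lam₃ ℓ₃).tail with hU₂
  have mR₂ : ∀ v ∈ U₂, ((v = vx k 0 1 ∨ v = vx k 0 eb ∨ v = vx k ρ₃ eb) ∨ v ∈ vseg k ρ₃ eb lam₃) ∨ (∃ q ∈ ℓ₃, v = vx k q lam₃) := fun v hv =>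
    (mem_trans_imp hv).imp (mR₁ v) (fun h => mem_lay.1 h)
  have RC : FPath k (U₂ ++ (vseg k a₃ lam₃ h₃).tail) (vx k 0 1) (vx k a₃ h₃) := by
    refine R₂.trans Q8 fun v hv hvS => ?_
    obtain ⟨i, hi1, hi2, rfl⟩ := mem_vseg.1 hv
    have hik : i ≤ k := le_trans hi2 (max_le hl3k hh₃)
    rcases mR₂ _ hvS with ((h | h | h) | h) | ⟨q, hq, he⟩
    · exact absurd ((vx_inj hik h1k).1 h).1 ha₃0
    · exact absurd ((vx_inj hik hebk).1 h).1 ha₃0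
    · -- `a₃ = ρ₃`: the ring case, `lam₃ = eb`
      obtain ⟨hq, hi⟩ := (vx_inj hik hebk).1 h
      have hr : triNorm a₃ = 1 := hq ▸ hρ₃
      rw [hi, hl3ring hr]
    · obtain ⟨j, hj1, hj2, he⟩ := mem_vseg.1 h
      have hjk : j ≤ k := le_trans hj2 (max_le hebk hl3k)
      obtain ⟨hq, hij⟩ := (vx_inj hik hjk).1 he
      have hr : triNorm a₃ = 1 := hq ▸ hρ₃
      have hl := hl3ring hr
      have hj : j = eb := by omega
      rw [hij, hj, hl]
    · obtain ⟨-, rfl⟩ := (vx_inj hik hl3k).1 he; rfl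
  set CB := U₂ ++ (vseg k a₃ lam₃ h₃).tail with hCB
  have mRC : ∀ v ∈ CB, (((v = vx k 0 1 ∨ v = vx k 0 eb ∨ v = vx k ρ₃ eb) ∨ v ∈ vseg k ρ₃ eb lam₃) ∨ (∃ q ∈ ℓ₃, v = vx k q lam₃)) ∨
      v ∈ vseg k a₃ lam₃ h₃ := fun v hv => (mem_trans_imp hv).imp (mR₂ v) id
  -- the branch misses `L`
  have hdisj : ∀ v ∈ CB.tail, v ∉ L := by
    intro v hv hvL
    have hvc : v ≠ vx k 0 1 := fun e => RC.not_mem_tail (e ▸ hv)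
    have hvCB : v ∈ CB := List.mem_of_mem_tail hv
    -- the column of `v` is `0` (at layer `eb`), `ρ₃`, a point of `ℓ₃`, or `a₃`; none of these occurs in `L` at a compatible layer
    rcases mRC v hvCB with (((h | h | h) | h) | ⟨q, hq, he⟩) | h
    · exact hvc h
    · -- `(0, eb)`
      subst h
      rcases mL _ hvL with (((⟨q, hq, he⟩ | h | h | h | h | h) | h) | ⟨q, hq, he⟩) | h
      · exact h0ℓ₁ (((vx_inj hebk hh₁).1 he).1 ▸ hq)
      · exact hρ₁0 (fst_of_mem_vseg h).symm
      · exact hρ₁0 ((vx_inj hebk h1k).1 h).1.symm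
      · exact heb1 ((vx_inj hebk h1k).1 h).2
      · exact hyb ((vx_inj hebk heyk).1 h).2.symm
      · exact hρ₂0 ((vx_inj hebk heyk).1 h).1.symm
      · exact hρ₂0 (fst_of_mem_vseg h).symm
      · exact h0ℓ₂ (((vx_inj hebk hl2k).1 he).1 ▸ hq)
      · exact ha₂0 (fst_of_mem_vseg h).symm
    · -- `(ρ₃, eb)`
      subst h
      rcases mL _ hvL with (((⟨q, hq, he⟩ | h | h | h | h | h) | h) | ⟨q, hq, he⟩) | h
      · exact hρ₃ℓ₁ (((vx_inj hebk hh₁).1 he).1 ▸ hq)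
      · exact h31 (fst_of_mem_vseg h)
      · exact h31 ((vx_inj hebk h1k).1 h).1
      · exact hρ₃0 ((vx_inj hebk h1k).1 h).1
      · exact hρ₃0 ((vx_inj hebk heyk).1 h).1
      · exact h32 ((vx_inj hebk heyk).1 h).1
      · exact h32 (fst_of_mem_vseg h)
      · exact hρ₃ℓ₂ (((vx_inj hebk hl2k).1 he).1 ▸ hq)
      · exact ha₂ρ₃ (fst_of_mem_vseg h).symm
    · -- column `ρ₃`
      have hc := fst_of_mem_vseg h
      rcases mL _ hvL with (((⟨q, hq, he⟩ | h' | h' | h' | h' | h') | h') | ⟨q, hq, he⟩) | h'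
      · rw [he] at hc; simp only [vx_fst] at hc; exact hρ₃ℓ₁ (hc ▸ hq)
      · exact h31 (hc.symm.trans (fst_of_mem_vseg h'))
      · rw [h'] at hc; exact h31 hc.symm
      · rw [h'] at hc; exact hρ₃0 hc.symm
      · rw [h'] at hc; exact hρ₃0 hc.symm
      · rw [h'] at hc; exact h32 hc.symm
      · exact h32 (hc.symm.trans (fst_of_mem_vseg h'))
      · rw [he] at hc; simp only [vx_fst] at hc; exact hρ₃ℓ₂ (hc ▸ hq)
      · exact ha₂ρ₃ ((fst_of_mem_vseg h').symm.trans hc)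
    · -- a vertex `(q, lam₃)` of the third leg
      subst he
      by_cases hr : triNorm a₃ = 1
      · -- ring case: `q = a₃`
        have hqa : q = a₃ := hℓ₃ring hr q hq
        subst hqa
        rcases mL _ hvL with (((⟨q', hq', he⟩ | h' | h' | h' | h' | h') | h') | ⟨q', hq', he⟩) | h'
        · exact ha₃ℓ₁ (((vx_inj hl3k hh₁).1 he).1 ▸ hq')
        · exact ha₃ρ₁ (fst_of_mem_vseg h')
        · exact ha₃ρ₁ ((vx_inj hl3k h1k).1 h').1
        · exact ha₃0 ((vx_inj hl3k h1k).1 h').1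
        · exact ha₃0 ((vx_inj hl3k heyk).1 h').1
        · exact ha₃ρ₂ ((vx_inj hl3k heyk).1 h').1
        · exact ha₃ρ₂ (fst_of_mem_vseg h')
        · exact ha₃ℓ₂ (((vx_inj hl3k hl2k).1 he).1 ▸ hq')
        · exact ha₃a₂ (fst_of_mem_vseg h')
      · obtain ⟨hl31, hl32⟩ := hl3ne hr
        rcases mL _ hvL with (((⟨q', hq', he⟩ | h' | h' | h' | h' | h') | h') | ⟨q', hq', he⟩) | h'
        · exact hl31 ((vx_inj hl3k hh₁).1 he).2
        · have := fst_of_mem_vseg h'; simp only [vx_fst] at this; exact hρ₁ℓ₃ (this ▸ hq)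
        · exact hρ₁ℓ₃ (((vx_inj hl3k h1k).1 h').1 ▸ hq)
        · exact h0ℓ₃ (((vx_inj hl3k h1k).1 h').1 ▸ hq)
        · exact h0ℓ₃ (((vx_inj hl3k heyk).1 h').1 ▸ hq)
        · exact hρ₂ℓ₃ (((vx_inj hl3k heyk).1 h').1 ▸ hq)
        · have := fst_of_mem_vseg h'; simp only [vx_fst] at this; exact hρ₂ℓ₃ (this ▸ hq)
        · exact hl32 ((vx_inj hl3k hl2k).1 he).2
        · have := fst_of_mem_vseg h'; simp only [vx_fst] at this; exact ha₂ℓ₃ (this ▸ hq)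
    · -- column `a₃`
      have hc := fst_of_mem_vseg h
      rcases mL _ hvL with (((⟨q, hq, he⟩ | h' | h' | h' | h' | h') | h') | ⟨q, hq, he⟩) | h'
      · rw [he] at hc; simp only [vx_fst] at hc; exact ha₃ℓ₁ (hc ▸ hq)
      · exact ha₃ρ₁ (hc.symm.trans (fst_of_mem_vseg h'))
      · rw [h'] at hc; exact ha₃ρ₁ hc.symm
      · rw [h'] at hc; exact ha₃0 hc.symm
      · rw [h'] at hc; exact ha₃0 hc.symm
      · rw [h'] at hc; exact ha₃ρ₂ hc.symm
      · exact ha₃ρ₂ (hc.symm.trans (fst_of_mem_vseg h'))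
      · rw [he] at hc; simp only [vx_fst] at hc; exact ha₃ℓ₂ (hc ▸ hq)
      · exact ha₃a₂ (hc.symm.trans (fst_of_mem_vseg h'))
  -- columns of the branch lie in `D`
  have hCBD : ∀ v ∈ CB.tail, ((v : triFilm k) : Site 2 × Site 1).1 ∈ D := by
    intro v hv
    rcases mRC v (List.mem_of_mem_tail hv) with (((h | h | h) | h) | ⟨q, hq, he⟩) | h
    · rw [h]; exact h0D
    · rw [h]; exact h0D
    · rw [h]; exact L3.rho_R
    · rw [fst_of_mem_vseg h]; exact L3.rho_R
    · rw [he]; exact L3.mem q hq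
    · rw [fst_of_mem_vseg h]; exact L3.a_R
  -- the decomposition of `L` at the hub edge `(0,1) → (0,e_y)`
  have hsplit : L = ((lay k h₁ ℓ₁).reverse ++ (vseg k ρ₁ h₁ 1).tail) ++ vx k 0 1 :: vx k 0 ey ::
      (vx k ρ₂ ey :: ((vseg k ρ₂ ey lam₂).tail ++ (lay k lam₂ ℓ₂).tail ++ (vseg k a₂ lam₂ h₂).tail)) := by
    simp only [hLdef, hT₄, hT₃, hT₂, List.tail_cons, List.append_assoc, List.cons_append, List.nil_append]
  have hCBne : CB.tail ≠ [] := by simp [hCB, hU₂, hU₁]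
  have hCBeq : CB = vx k 0 1 :: vx k 0 eb :: (vx k ρ₃ eb :: ((vseg k ρ₃ eb lam₃).tail ++ (lay k lam₃ ℓ₃).tail ++ (vseg k a₃ lam₃ h₃).tail)) := by
    simp only [hCB, hU₂, hU₁, List.append_assoc, List.cons_append, List.nil_append]
  refine ⟨routeData_of_paths SL hE hLRP hsplit RC hCBne hCBD hdisj, rfl, routeData_of_paths_b SL hE hLRP hsplit RC hCBne hCBD hdisj hCBeq⟩

/-- **THE SWAP PAIR FROM THE LEGS** (`k ≥ 2`): the two routings `(e_y, e_b) = (2, 0)` and `(0, 2)` of the template.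
[cite: DuminilCopinSidoraviciusTassion2016, §2.3 (proof of Fact 2)] -/
theorem exists_swap_pair_of_legs (hk : 2 ≤ k) {RP D : Set (Site 2)} (h0R : (0 : Site 2) ∈ RP) (h0D : (0 : Site 2) ∈ D) {a₁ a₂ a₃ ρ₁ ρ₂ ρ₃ : Site 2}
    {ℓ₁ ℓ₂ ℓ₃ : List (Site 2)} (L1 : Leg RP {q | q ≠ a₁ ∧ (q = a₂ ∨ q = a₃)} ρ₁ a₁ ℓ₁) (L2 : Leg RP {q | q ≠ a₂ ∧ (q = a₁ ∨ q = a₃)} ρ₂ a₂ ℓ₂)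
    (L3 : Leg D {q | q = a₁ ∨ q = a₂} ρ₃ a₃ ℓ₃) (h12 : ρ₁ ≠ ρ₂) (h31 : ρ₃ ≠ ρ₁) (h32 : ρ₃ ≠ ρ₂) (ha₁ : triNorm a₁ = 3) (ha₂ : triNorm a₂ = 3)
    {h₁ h₂ h₃ : ℕ} (hh₁ : h₁ ≤ k) (hh₂ : h₂ ≤ k) (hh₃ : h₃ ≤ k) (hE : vx k a₁ h₁ ≠ vx k a₂ h₂) :
    ∃ r₁ r₂ : (hexShadow k).RouteData RP D (vx k a₁ h₁) (vx k a₂ h₂) (vx k a₃ h₃), r₁.y = r₂.b ∧ r₁.b = r₂.y := by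
  obtain ⟨r₁, hy₁, hb₁⟩ := exists_route_of_legs hk h0R h0D L1 L2 L3 h12 h31 h32 ha₁ ha₂ hh₁ hh₂ hh₃ hE (ey := 2) (eb := 0) (Or.inr rfl) (Or.inl rfl)
    (by norm_num)
  obtain ⟨r₂, hy₂, hb₂⟩ := exists_route_of_legs hk h0R h0D L1 L2 L3 h12 h31 h32 ha₁ ha₂ hh₁ hh₂ hh₃ hE (ey := 0) (eb := 2) (Or.inl rfl) (Or.inr rfl)
    (by norm_num)
  exact ⟨r₁, r₂, by rw [hy₁, hb₂], by rw [hb₁, hy₂]⟩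

end TriFilm

end Summit.CriticalPhenomena.PercolationContinuityZ3.Theorems.Transplant

end
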